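import Summits.KontsevichZagierPeriods.KontsevichZagierPeriods.Theses.GenusOneIterated
import Summits.KontsevichZagierPeriods.KontsevichZagierPeriods.Theorems.GenusOneIteratedLegendreLemniscaticBetaUnit
import Summits.KontsevichZagierPeriods.KontsevichZagierPeriods.Theorems.GenusOneIteratedLegendreLemniscaticSquare
import Summits.KontsevichZagierPeriods.KontsevichZagierPeriods.Theorems.TerasomaMultiplicationGammaHodgeFromRelatorsChains
import Summits.KontsevichZagierPeriods.KontsevichZagierPeriods.Theorems.CompiledSubstitutionsPiNormalisation

/-!
# Route GenusOneIterated — support item `LegendreLemniscatic` (stmt-KontsevichZagierPeriods-6781)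

**Legendre's relation is depth one.** For the lemniscatic curve `y² = 4x³ − 4x` (`g₂ = 4`, `g₃ = 0`,
2-torsion abscissae `−1 < 0 < 1`) the half-periods along the bounded real oval are
`ω₁/2 = ∫_{-1}^{0} dx/y` and `−η₁/2 = ∫_{-1}^{0} x dx/y`, and Legendre's relation at the CM point reads
`ω₁η₁ = π`. The item files it INSIDE the Kontsevich–Zagier calculus of moves: every representation
`r = [(-1,0)², −4x₁/(y₀y₁)]` (value `−4·(ω₁/2)·(−η₁/2) = ω₁η₁`) is `KZ.Equivalent` to every
representation `r' = [ℝ, dv/(1+v²)]` (value `π`).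

## Proof (a chain of rule (1)–(3) moves, assembled in the formal period ring `P = KZ.FormalPeriodRing`)

1. ONE change of variables `(x₀,x₁) ↦ (x₁², x₀²)` (rule (2)) turns `r` into `¼·B`, `B` the cube Beta
   box `[(0,1)², u^{3/4−1}(1−u)^{1/2−1} v^{1/4−1}(1−v)^{1/2−1}]`
   (`lemniscaticSquare_equivalent_constMul`, helper file `…LegendreLemniscaticSquare`); in `P`:
   `⟦r⟧ = κ(¼)·⟦B⟧` (`KZ.toFormalPeriod_of_constMul`).
2. Fubini inside the rules: `⟦B⟧ = β(¾,½)·β(¼,½)` (`KZ.cubeBetaRep_toFormalPeriod_eq_prod`, classes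
   `betaClass` of `TerasomaMultiplicationGammaHodgeSectorDefs`).
3. Dirichlet's re-association at `(a,b,c) = (¼,½,½)` (two polynomial charts of the 2-simplex, tree
   theorem `betaClass_reassoc`): `β(¼,½)·β(¾,½) = β(½,½)·β(¼,1)`.
4. ONE Newton–Leibniz move `∫₀¹ ¼u^{-3/4} du = 1`: `κ(¼)·β(¼,1) = 1`
   (`toFormalPeriod_unit_constMul_mul_betaFirstOne`, helper file `…LegendreLemniscaticBetaUnit`).
5. `β(½,½) = ⟦[disc, 1]⟧` (Kontsevich–Zagier's §1.1 example, tree theorem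
   `betaClass_half_half_eq_piRep`) and `[ℝ, dv/(1+v²)] ∼ [disc, 1]` (tree theorem
   `piNormalisation_proof`, substitution `v = 2t/(1−t²)` then `x = 2t/(1+t²)`).

Hence `⟦r⟧ = ⟦r'⟧`, i.e. `[r] − [r'] ∈ KZ.relations` (`KZ.toFormalPeriod_eq_iff`). Value bookkeeping:
`ω₁η₁ = ¼·B(¾,½)·B(¼,½) = ¼·B(½,½)·B(¼,1) = ¼·π·4 = π`.

References: M. Kontsevich, D. Zagier, *Periods* (2001), §1.1–1.2, §4.1; H. McKean, V. Moll,
*Elliptic Curves* (1999), Ch. 2 (the lemniscatic integral, Legendre's relation); G. Andrews, R. Askey,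
R. Roy, *Special Functions* (1999), §1.1 (`B(a,1) = 1/a`, `B(½,½) = π`) and Thm 1.8.1 (Dirichlet).
-/

noncomputable section

namespace Summit.KontsevichZagierPeriods.GenusOneIterated.LegendreLemniscatic

open MeasureTheory Set
open Literature.NumberTheory.Transcendental
open Literature.NumberTheory.Transcendental.KZ
open Summit.KontsevichZagierPeriods.GammaHodgeSectorKO (betaRep kap betaClass betaClass_eq)
open Summit.KontsevichZagierPeriods.TerasomaMultiplication.GammaHodgeFromRelators
  (betaClass_reassoc betaClass_half_half_eq_piRep)
open Summit.KontsevichZagierPeriods.CompiledSubstitutions.PiNormalisation (piNormalisation_proof)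
open Summit.KontsevichZagierPeriods.KontsevichZagierPeriods.Theorems
  (toFormalPeriod_unit_constMul_mul_betaFirstOne lemniscaticSquare_equivalent_constMul
    exists_lemniscaticBetaBox)

/-- **`κ(¼)·⟦B⟧ = β(½,½)` in the formal period ring** for a representation `B` pinned as the cube
Beta box of the data `x = (¾, ¼)`, `y = (½, ½)`: Fubini `⟦B⟧ = β(¾,½)·β(¼,½)`, Dirichlet's
re-association `β(¼,½)·β(¾,½) = β(½,½)·β(¼,1)` and `κ(¼)·β(¼,1) = 1`. Value identity
`¼·B(¾,½)·B(¼,½) = B(½,½) = π`. [cite: AndrewsAskeyRoy1999, Thm 1.8.1] -/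
theorem kap_quarter_mul_toFormalPeriod_betaBox (B : IntegralRep 2)
    (hq : IsAlgebraic ℚ (((1 / 4 : ℚ) : ℚ) : ℝ))
    (hBd : B.domain = {t | ∀ j, t j ∈ Set.Ioo (0:ℝ) 1})
    (hBi : Set.EqOn B.integrand (fun t => ∏ j, (t j) ^ (((![3 / 4, 1 / 4] : Fin 2 → ℚ) j : ℝ) - 1) *
      (1 - t j) ^ (((![1 / 2, 1 / 2] : Fin 2 → ℚ) j : ℝ) - 1)) B.domain) :
    kap (((1 / 4 : ℚ) : ℚ) : ℝ) hq * toFormalPeriod (of B) = betaClass (1 / 2) (1 / 2) := by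
  have h34 : (0 : ℚ) < 3 / 4 := by norm_num
  have h14 : (0 : ℚ) < 1 / 4 := by norm_num
  have h12 : (0 : ℚ) < 1 / 2 := by norm_num
  -- (2) Fubini: `⟦B⟧ = β(¾,½)·β(¼,½)`
  have hB : toFormalPeriod (of B) = betaClass (3 / 4) (1 / 2) * betaClass (1 / 4) (1 / 2) := by
    have h := cubeBetaRep_toFormalPeriod_eq_prod ![3 / 4, 1 / 4] ![1 / 2, 1 / 2]
      (fun j => by fin_cases j <;> norm_num) B
      ![betaRep (3 / 4) (1 / 2) h34 h12, betaRep (1 / 4) (1 / 2) h14 h12] hBd hBi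
      (fun j => by fin_cases j <;> exact Set.ext fun _ => Iff.rfl)
      (fun j => by fin_cases j <;> exact fun _ _ => rfl)
    rw [h, Fin.prod_univ_two]
    simp only [Matrix.cons_val_zero, Matrix.cons_val_one]
    rw [← betaClass_eq, ← betaClass_eq]
  -- (3) Dirichlet: `β(¼,½)·β(¾,½) = β(½,½)·β(¼,1)`
  have hdir := betaClass_reassoc (1 / 4) (1 / 2) (1 / 2) h14 h12 h12
  rw [show (1 / 4 + 1 / 2 : ℚ) = 3 / 4 by norm_num, show (1 / 2 + 1 / 2 : ℚ) = 1 by norm_num] at hdir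
  -- (4) Newton–Leibniz: `κ(¼)·β(¼,1) = 1`
  have hunit : kap (((1 / 4 : ℚ) : ℚ) : ℝ) hq * betaClass (1 / 4) 1 = 1 := by
    rw [betaClass_eq (1 / 4) 1 h14 one_pos]
    exact toFormalPeriod_unit_constMul_mul_betaFirstOne (1 / 4) h14 (betaRep (1 / 4) 1 h14 one_pos)
      (Set.ext fun _ => Iff.rfl) (fun _ _ => rfl) hq
  calc kap (((1 / 4 : ℚ) : ℚ) : ℝ) hq * toFormalPeriod (of B)
      = kap (((1 / 4 : ℚ) : ℚ) : ℝ) hq * (betaClass (1 / 4) (1 / 2) * betaClass (3 / 4) (1 / 2)) := by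
        rw [hB, mul_comm (betaClass (3 / 4) (1 / 2))]
    _ = betaClass (1 / 2) (1 / 2) * (kap (((1 / 4 : ℚ) : ℚ) : ℝ) hq * betaClass (1 / 4) 1) := by
        rw [hdir]; ring
    _ = betaClass (1 / 2) (1 / 2) := by rw [hunit, mul_one]

/-- **Support item `LegendreLemniscatic`** (stmt-KontsevichZagierPeriods-6781, route GenusOneIterated):
Legendre's relation `ω₁η₁ = π` for `y² = 4x³ − 4x` inside the Kontsevich–Zagier calculus —
`[(-1,0)², −4x₁/(y₀y₁)] ∼ [ℝ, dv/(1+v²)]` for all representations with these domains and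
integrands. Moves: the chart `(x₀,x₁) ↦ (x₁²,x₀²)` onto `¼·(Beta box)`, Fubini, Dirichlet's two
charts, one Newton–Leibniz move, and the `π`-normalisation chain `β(½,½) ∼ disc ∼ [ℝ, dv/(1+v²)]`;
assembled in the formal period ring. [cite: KontsevichZagier2001, §1.2] -/
theorem legendreLemniscatic_proof :
    Summit.KontsevichZagierPeriods.KontsevichZagierPeriods.Theses.GenusOneIterated.LegendreLemniscatic := by
  unfold Summit.KontsevichZagierPeriods.KontsevichZagierPeriods.Theses.GenusOneIterated.LegendreLemniscatic
  intro r r' hrd hri hr'd hr'i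
  have hq : IsAlgebraic ℚ (((1 / 4 : ℚ) : ℚ) : ℝ) := isAlgebraic_algebraMap _
  obtain ⟨B, hBd, hBi⟩ := exists_lemniscaticBetaBox
  -- (1) the chart: `⟦r⟧ = κ(¼)·⟦B⟧`
  have h1 := (lemniscaticSquare_equivalent_constMul r B hq hrd hri hBd hBi).toFormalPeriod_eq
  rw [toFormalPeriod_of_constMul] at h1
  -- (2)–(4): `κ(¼)·⟦B⟧ = β(½,½)`
  have h2 : kap (((1 / 4 : ℚ) : ℚ) : ℝ) hq * toFormalPeriod (of B) = betaClass (1 / 2) (1 / 2) :=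
    kap_quarter_mul_toFormalPeriod_betaBox B hq hBd hBi
  -- (5) `β(½,½) = ⟦disc⟧ = ⟦r'⟧`
  have h3 : toFormalPeriod (of r') = toFormalPeriod (of piRep) :=
    ((piNormalisation_proof piRep rfl (fun _ _ => rfl)).1 r' hr'd hr'i).toFormalPeriod_eq
  exact toFormalPeriod_eq_iff.mp (h1.trans ((h2.trans betaClass_half_half_eq_piRep).trans h3.symm))

end Summit.KontsevichZagierPeriods.GenusOneIterated.LegendreLemniscatic
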